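import Literature.MathematicalPhysics.QuantumLattice.DWaveSourceNNNHoppingFlatTwistEnergyDensity
import Literature.MathematicalPhysics.QuantumLattice.DWaveSourceNNNHoppingFlatTwistChordLimit
import Literature.MathematicalPhysics.QuantumLattice.SourcedTorusGroundStatePairLROFloor
import HarnessLib

/-!
# The ground-state energy density of the FLAT-TWISTED pair-sourced `t–t'` Hubbard torus converges along every
# trivial-holonomy sequence: `E₀(dWaveSourceTorusTT'Twist L_j t' U μ h n_j)/L_j² → e_src^tw(t',U,μ,h;κ)`
# (`χ_{L_j}(n_j) = κ`); `κ = 1`; ladders; the sourced helicity chord density exists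

Topic `Literature/MathematicalPhysics/QuantumLattice` (namespace = path; family `hubbard`). Sequel of
`DWaveSourceNNNHoppingFlatTwistLocalDensity.lean` (hubbard-cq-p3: the gauge-rotated local objective
`dWaveSourceEnergyObsTT'Twist t' U μ h κ`, its periodisation `dWaveSourceTorusTT'TwistU1 L t' U μ h κ` on every side,
`= dWaveSourceTorusTT'Twist L t' U μ h n` whenever `χ_L(n_i) = κ_i` and `L ≥ 3`, and the model-free limit
`exists_tendsto_groundEnergy_dWaveSourceTorusTT'TwistU1_div_sq` along ALL sides) and of
`DWaveSourceNNNHoppingFlatTwistEnergyDensity.lean` (the name `dWaveSourceEnergyDensityTT'Twist t' U μ h κ` for the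
Bratteli–Kishimoto–Robinson mean-energy minimum of that objective). Written for the Hubbard cuprate cell's row T8
«sourced helicity chord» (`hubbard-cq`, card `sourced-helicity-chord`), whose one remaining Lean item was the
EXISTENCE of the thermodynamic limit of the chord per site `(E₀(dWaveSourceTorusTT'Twist L h n_L) − E₀(A_L(h)))/L²`
along the card's ladder (`q = 4πn_L/L` fixed, e.g. `L ∈ 8ℕ`, `n_L = (L/8, 0)` for `q = (π/2)·x̂`), the one-sided TL
ceiling being `DWaveSourceNNNHoppingFlatTwistChordLimit.lean`.

* §1 `dWaveSourceEnergyDensityTT'Twist_spec` — the all-sides limit is the named constant (it is the LEAST mean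
  energy, hence the `sInf` of the definition), read on the tori where the prescribed twists have trivial holonomy:
  **`tendsto_groundEnergy_dWaveSourceTorusTT'Twist_div_sq`** — for every `κ ∈ U(1)²`, every sequence of sides
  `L_j → ∞` and twists `n_j ∈ (ℤ/L_j)²` with `χ_{L_j}(n_{j,i}) = κ_i`,
  `E₀(dWaveSourceTorusTT'Twist L_j t' U μ h n_j)/L_j² → e_src^tw(t',U,μ,h;κ)` (the SAME limit for all such
  sequences; `(L+1)`-indexed form `…_succ_div_sq`); `dWaveSourceEnergyDensityTT'Twist_le_re_expect` (variational
  principle), `exists_re_expect_eq_dWaveSourceEnergyDensityTT'Twist` (attained);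
  **`dWaveSourceEnergyDensityTT'Twist_one`**: `e_src^tw(…;1) = e_src(t',U,μ,h)`; certified finite-volume lower /
  upper bounds along such a sequence pass to the limit.
* §2 LADDERS `q = 4πp/b`: along the sides `b(m+1)` with twists `n_i = p_i(m+1)` the energy density converges to
  `e_src^tw(…; χ_b(p))` (`tendsto_groundEnergy_dWaveSourceTorusTT'Twist_ladder_div_sq`; `b = 8`, `p = (1,0)` is
  `q = (π/2)·x̂`). THE SOURCED HELICITY CHORD DENSITY EXISTS along every trivial-holonomy sequence,
  `(E₀(twist L_j, n_j) − E₀(A_{L_j}(h)))/L_j² → e_src^tw(κ) − e_src(h)` (`tendsto_sourcedHelicityChord_div_sq`),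
  and obeys the ceiling `e_src^tw(κ) − e_src(h) ≤ e_src(0) − e_src(h)` (`helicityChordDensity_le_sourcedGainDensity`,
  the finite-torus `sourcedHelicityChord_le_sourcedGain` in the limit; ladder form `…_ladder_…`).

HONEST SCOPE: grand-canonical ground-state energies (`Matrix.groundEnergy`, whole Fock space); hopping `t = 1`;
existence and variational meaning of an energy density and a one-sided comparison; no number, no floor on any
order parameter, nothing about superconductivity. Everything is PROVED; no definition, no named fact.

## References
* T. Koma, H. Tasaki, J. Stat. Phys. 76 (1994) 745, §1. [cite: KomaTasaki1994, §1]
* O. Bratteli, A. Kishimoto, D. W. Robinson, CMP 64 (1978) 41, Thm. 2. [cite: BratteliKishimotoRobinson1978, Thm. 2]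
* D. Ruelle, *Statistical Mechanics* (1969), §3.3 (energy densities as limits). [cite: Ruelle1969, §3.3]
* H. Watanabe, J. Stat. Phys. 177 (2019) 717, §2.2.1 (flat twists). [cite: Watanabe2019, §2.2.1]
-/

noncomputable section

namespace Literature.MathematicalPhysics.QuantumLattice

open _root_.Matrix Finset HubbardWave0 Literature.Probability.LatticeModels _root_.Filter
open scoped _root_.Topology

/-! ### §1 The limit along trivial-holonomy sequences; variational characterisation; `κ = 1` -/

section Limit

/-- **THE MASTER STATEMENT**: the all-sides limit of the periodised rotated objective
(`exists_tendsto_groundEnergy_dWaveSourceTorusTT'TwistU1_div_sq`) is the least mean energy of a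
translation-invariant state, i.e. the constant `dWaveSourceEnergyDensityTT'Twist t' U μ h κ`; read on the tori where
the prescribed twists have `χ_L(n_i) = κ_i` (there the periodisation IS `dWaveSourceTorusTT'Twist`): convergence
along every such sequence of sides `L_j → ∞`, the variational lower bound, and attainment.
[cite: BratteliKishimotoRobinson1978, Thm. 2] -/
theorem dWaveSourceEnergyDensityTT'Twist_spec (t' U μ h : ℝ) (κ : Fin 2 → Circle) :
    (∀ (Ls : ℕ → ℕ) [∀ j, NeZero (Ls j)], Tendsto Ls atTop atTop →
      ∀ n : ∀ j, Fin 2 → ZMod (Ls j), (∀ j i, ZMod.toCircle (n j i) = κ i) →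
        Tendsto (fun j => (dWaveSourceTorusTT'Twist (Ls j) t' U μ h (n j)).groundEnergy / ((Ls j : ℕ) : ℝ) ^ 2)
          atTop (𝓝 (dWaveSourceEnergyDensityTT'Twist t' U μ h κ))) ∧
    (∀ ω : InfVolFermionState 2, ω.IsTranslationInvariant →
      dWaveSourceEnergyDensityTT'Twist t' U μ h κ ≤
        (ω.expect dWaveSourceWindow (dWaveSourceEnergyObsTT'Twist t' U μ h κ)).re) ∧
    ∃ ω : InfVolFermionState 2, ω.IsTranslationInvariant ∧
      (ω.expect dWaveSourceWindow (dWaveSourceEnergyObsTT'Twist t' U μ h κ)).re =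
        dWaveSourceEnergyDensityTT'Twist t' U μ h κ := by
  obtain ⟨e, hconv, hle, ω, hω, hωe⟩ := exists_tendsto_groundEnergy_dWaveSourceTorusTT'TwistU1_div_sq t' U μ h κ
  -- the limit is the least mean energy, i.e. the `sInf` of the definition
  have he : dWaveSourceEnergyDensityTT'Twist t' U μ h κ = e := by
    rw [dWaveSourceEnergyDensityTT'Twist]
    exact IsLeast.csInf_eq ⟨⟨ω, hω, hωe⟩, by rintro x ⟨ω', hω', rfl⟩; exact hle ω' hω'⟩
  rw [he]
  refine ⟨fun Ls _ hLs n hn => ?_, hle, ω, hω, hωe⟩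
  -- on the sides where the window fits and `L ≥ 3`, the periodisation IS the T8 object
  obtain ⟨L₁, hL₁⟩ := exists_forall_le_injOn_proj (d := 2) dWaveSourceWindow
  have key : ∀ (L : ℕ) [NeZero L] (nL : Fin 2 → ZMod L), (∀ i, ZMod.toCircle (nL i) = κ i) → max 3 L₁ ≤ L →
      (dWaveSourceTorusTT'TwistU1 (L - 1 + 1) t' U μ h κ).groundEnergy / (((L - 1 + 1 : ℕ) : ℝ)) ^ 2 =
        (dWaveSourceTorusTT'Twist L t' U μ h nL).groundEnergy / ((L : ℕ) : ℝ) ^ 2 := by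
    intro L _ nL hnL hML
    obtain ⟨m, rfl⟩ : ∃ m, L = m + 1 := ⟨L - 1, (Nat.sub_add_cancel (by omega)).symm⟩
    rw [Nat.add_sub_cancel,
      dWaveSourceTorusTT'TwistU1_eq_twist (by omega) (hL₁ _ (by omega)) t' U μ h κ nL hnL]
  have hK : Tendsto (fun j => Ls j - 1) atTop atTop := (tendsto_sub_atTop_nat 1).comp hLs
  refine (hconv.comp hK).congr' ?_
  filter_upwards [hLs.eventually_ge_atTop (max 3 L₁)] with j hj
  rw [Function.comp_apply]
  exact key (Ls j) (n j) (hn j) hj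

/-- **THE LIMIT EXISTS along every trivial-holonomy sequence**: for every `κ ∈ U(1)²`, every sequence of sides
`L_j → ∞` and twists `n_j ∈ (ℤ/L_j)²` with `χ_{L_j}(n_{j,i}) = κ_i`,
`E₀(dWaveSourceTorusTT'Twist L_j t' U μ h n_j)/L_j² → e_src^tw(t',U,μ,h;κ)` — the same limit for all such
sequences. [cite: Ruelle1969, §3.3] -/
theorem tendsto_groundEnergy_dWaveSourceTorusTT'Twist_div_sq (t' U μ h : ℝ) (κ : Fin 2 → Circle)
    (Ls : ℕ → ℕ) [∀ j, NeZero (Ls j)] (hLs : Tendsto Ls atTop atTop) (n : ∀ j, Fin 2 → ZMod (Ls j))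
    (hn : ∀ j i, ZMod.toCircle (n j i) = κ i) :
    Tendsto (fun j => (dWaveSourceTorusTT'Twist (Ls j) t' U μ h (n j)).groundEnergy / ((Ls j : ℕ) : ℝ) ^ 2)
      atTop (𝓝 (dWaveSourceEnergyDensityTT'Twist t' U μ h κ)) :=
  (dWaveSourceEnergyDensityTT'Twist_spec t' U μ h κ).1 Ls hLs n hn

/-- The same along the sides `L + 1` (the shape of `DWaveSourceNNNHoppingFlatTwistChordLimit.lean`): for every twist
sequence `n_L ∈ (ℤ/(L+1))²` with `χ_{L+1}(n_{L,i}) = κ_i`,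
`E₀(dWaveSourceTorusTT'Twist (L+1) t' U μ h n_L)/(L+1)² → e_src^tw(κ)`. [cite: Ruelle1969, §3.3] -/
theorem tendsto_groundEnergy_dWaveSourceTorusTT'Twist_succ_div_sq (t' U μ h : ℝ) (κ : Fin 2 → Circle)
    (n : ∀ L : ℕ, Fin 2 → ZMod (L + 1)) (hn : ∀ L i, ZMod.toCircle (n L i) = κ i) :
    Tendsto (fun L : ℕ => (dWaveSourceTorusTT'Twist (L + 1) t' U μ h (n L)).groundEnergy / (((L + 1 : ℕ) : ℝ)) ^ 2)
      atTop (𝓝 (dWaveSourceEnergyDensityTT'Twist t' U μ h κ)) :=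
  tendsto_groundEnergy_dWaveSourceTorusTT'Twist_div_sq t' U μ h κ (fun L => L + 1) (tendsto_add_atTop_nat 1) n hn

/-- The all-sides limit of the uniformly twisted torus is the named constant too:
`E₀(dWaveSourceTorusTT'TwistU1 (L+1) t' U μ h κ)/(L+1)² → e_src^tw(κ)`. [cite: BratteliKishimotoRobinson1978, Thm. 2] -/
theorem tendsto_groundEnergy_dWaveSourceTorusTT'TwistU1_div_sq (t' U μ h : ℝ) (κ : Fin 2 → Circle) :
    Tendsto (fun L : ℕ => (dWaveSourceTorusTT'TwistU1 (L + 1) t' U μ h κ).groundEnergy / (((L + 1 : ℕ) : ℝ)) ^ 2)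
      atTop (𝓝 (dWaveSourceEnergyDensityTT'Twist t' U μ h κ)) := by
  obtain ⟨e, hconv, hle, ω, hω, hωe⟩ := exists_tendsto_groundEnergy_dWaveSourceTorusTT'TwistU1_div_sq t' U μ h κ
  have he : dWaveSourceEnergyDensityTT'Twist t' U μ h κ = e := by
    rw [dWaveSourceEnergyDensityTT'Twist]
    exact IsLeast.csInf_eq ⟨⟨ω, hω, hωe⟩, by rintro x ⟨ω', hω', rfl⟩; exact hle ω' hω'⟩
  rwa [he]

/-- **Variational principle**: `e_src^tw(t',U,μ,h;κ) ≤ Re ω(E^src_κ)` for every translation-invariant infinite-volume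
state `ω`. [cite: BratteliKishimotoRobinson1978, Thm. 2] -/
theorem dWaveSourceEnergyDensityTT'Twist_le_re_expect (t' U μ h : ℝ) (κ : Fin 2 → Circle)
    (ω : InfVolFermionState 2) (hω : ω.IsTranslationInvariant) :
    dWaveSourceEnergyDensityTT'Twist t' U μ h κ ≤
      (ω.expect dWaveSourceWindow (dWaveSourceEnergyObsTT'Twist t' U μ h κ)).re :=
  (dWaveSourceEnergyDensityTT'Twist_spec t' U μ h κ).2.1 ω hω

/-- **The minimum is attained**: some translation-invariant state has `Re ω(E^src_κ) = e_src^tw(κ)` (a torus limit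
of ground-state vectors of the periodised objective). [cite: BratteliKishimotoRobinson1978, Thm. 2] -/
theorem exists_re_expect_eq_dWaveSourceEnergyDensityTT'Twist (t' U μ h : ℝ) (κ : Fin 2 → Circle) :
    ∃ ω : InfVolFermionState 2, ω.IsTranslationInvariant ∧
      (ω.expect dWaveSourceWindow (dWaveSourceEnergyObsTT'Twist t' U μ h κ)).re =
        dWaveSourceEnergyDensityTT'Twist t' U μ h κ :=
  (dWaveSourceEnergyDensityTT'Twist_spec t' U μ h κ).2.2

/-- **At `κ = 1` the twisted energy density is the sourced energy density `e_src(t',U,μ,h)`** (zero twist on every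
side: `dWaveSourceTorusTT'Twist L t' U μ h 0 = A_L(h)`). [cite: KomaTasaki1994, §1] -/
theorem dWaveSourceEnergyDensityTT'Twist_one (t' U μ h : ℝ) :
    dWaveSourceEnergyDensityTT'Twist t' U μ h 1 = dWaveSourceEnergyDensityTT' t' U μ h := by
  have h1 := tendsto_groundEnergy_dWaveSourceTorusTT'Twist_succ_div_sq t' U μ h 1 (fun _ => 0)
    (fun L i => by rw [Pi.zero_apply, AddChar.map_zero_eq_one, Pi.one_apply])
  have h2 : Tendsto (fun L : ℕ => (dWaveSourceTorusTT'Twist (L + 1) t' U μ h 0).groundEnergy /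
      (((L + 1 : ℕ) : ℝ)) ^ 2) atTop (𝓝 (dWaveSourceEnergyDensityTT' t' U μ h)) := by
    refine (tendsto_dWaveSourceEnergyDensityTT' t' U μ h).congr' ?_
    filter_upwards [eventually_ge_atTop 2] with L hL
    rw [dWaveSourceTorusTT'Twist_zero_twist (L + 1) (by omega)]
  exact tendsto_nhds_unique h1 h2

/-- **Certified lower bounds pass to the limit**: if `lo · L_j² ≤ E₀(dWaveSourceTorusTT'Twist L_j t' U μ h n_j)`
eventually along a trivial-holonomy sequence, then `lo ≤ e_src^tw(κ)`. [cite: Ruelle1969, §3.3] -/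
theorem dWaveSourceEnergyDensityTT'Twist_ge_of_eventually_le (t' U μ h : ℝ) (κ : Fin 2 → Circle)
    (Ls : ℕ → ℕ) [∀ j, NeZero (Ls j)] (hLs : Tendsto Ls atTop atTop) (n : ∀ j, Fin 2 → ZMod (Ls j))
    (hn : ∀ j i, ZMod.toCircle (n j i) = κ i) {lo : ℝ}
    (hlo : ∀ᶠ j in atTop, lo * ((Ls j : ℕ) : ℝ) ^ 2 ≤ (dWaveSourceTorusTT'Twist (Ls j) t' U μ h (n j)).groundEnergy) :
    lo ≤ dWaveSourceEnergyDensityTT'Twist t' U μ h κ := by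
  refine ge_of_tendsto (tendsto_groundEnergy_dWaveSourceTorusTT'Twist_div_sq t' U μ h κ Ls hLs n hn) ?_
  filter_upwards [hlo, hLs.eventually_ge_atTop 1] with j hj hj1
  have hpos : (0 : ℝ) < ((Ls j : ℕ) : ℝ) ^ 2 := by
    have : (1 : ℝ) ≤ ((Ls j : ℕ) : ℝ) := by exact_mod_cast hj1
    positivity
  rwa [le_div_iff₀ hpos]

/-- **Certified upper bounds pass to the limit**: if `E₀(dWaveSourceTorusTT'Twist L_j t' U μ h n_j) ≤ hi · L_j²`
eventually along a trivial-holonomy sequence (e.g. Rayleigh quotients of trial states), then `e_src^tw(κ) ≤ hi`.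
[cite: Ruelle1969, §3.3] -/
theorem dWaveSourceEnergyDensityTT'Twist_le_of_eventually_le (t' U μ h : ℝ) (κ : Fin 2 → Circle)
    (Ls : ℕ → ℕ) [∀ j, NeZero (Ls j)] (hLs : Tendsto Ls atTop atTop) (n : ∀ j, Fin 2 → ZMod (Ls j))
    (hn : ∀ j i, ZMod.toCircle (n j i) = κ i) {hi : ℝ}
    (hhi : ∀ᶠ j in atTop, (dWaveSourceTorusTT'Twist (Ls j) t' U μ h (n j)).groundEnergy ≤ hi * ((Ls j : ℕ) : ℝ) ^ 2) :
    dWaveSourceEnergyDensityTT'Twist t' U μ h κ ≤ hi := by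
  refine le_of_tendsto (tendsto_groundEnergy_dWaveSourceTorusTT'Twist_div_sq t' U μ h κ Ls hLs n hn) ?_
  filter_upwards [hhi, hLs.eventually_ge_atTop 1] with j hj hj1
  have hpos : (0 : ℝ) < ((Ls j : ℕ) : ℝ) ^ 2 := by
    have : (1 : ℝ) ≤ ((Ls j : ℕ) : ℝ) := by exact_mod_cast hj1
    positivity
  rwa [div_le_iff₀ hpos]

end Limit

/-! ### §2 The card's ladders `q = 4πp/b`; the sourced helicity chord density -/

section Ladder

/-- **THE LIMIT ALONG A LADDER**: for `b ≥ 1` and `p ∈ ℕ²`, along the sides `L_m = b(m+1)` with twists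
`n_{m,i} = p_i(m+1)` (fixed wave vector `q_i = 4πp_i/b`; `χ_{b(m+1)}(p_i(m+1)) = χ_b(p_i)`, the tree's
`toCircle_mul_eq`), `E₀(dWaveSourceTorusTT'Twist (b(m+1)) t' U μ h (p(m+1)))/(b(m+1))² → e_src^tw(t',U,μ,h; χ_b(p))`;
e.g. `b = 8`, `p = (1, 0)` is the card's `q = (π/2)·x̂` along `L ∈ 8ℕ`, `b = 16` its `q = (π/4)·x̂`.
[cite: KomaTasaki1994, §1] -/
theorem tendsto_groundEnergy_dWaveSourceTorusTT'Twist_ladder_div_sq (t' U μ h : ℝ) (b : ℕ) [NeZero b]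
    (p : Fin 2 → ℕ) :
    Tendsto (fun m : ℕ => (dWaveSourceTorusTT'Twist (b * (m + 1)) t' U μ h
        (fun i => ((p i * (m + 1) : ℕ) : ZMod (b * (m + 1))))).groundEnergy / (((b * (m + 1) : ℕ) : ℝ)) ^ 2)
      atTop (𝓝 (dWaveSourceEnergyDensityTT'Twist t' U μ h (fun i => ZMod.toCircle ((p i : ℕ) : ZMod b)))) :=
  tendsto_groundEnergy_dWaveSourceTorusTT'Twist_div_sq t' U μ h _ (fun m => b * (m + 1))
    ((tendsto_add_atTop_nat 1).const_mul_atTop' (Nat.pos_of_ne_zero (NeZero.ne b))) _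
    (fun m i => toCircle_mul_eq b (m + 1) (p i))

/-- **THE SOURCED HELICITY CHORD DENSITY EXISTS** along every trivial-holonomy sequence:
`(E₀(dWaveSourceTorusTT'Twist L_j t' U μ h n_j) − E₀(A_{L_j}(h)))/L_j² → e_src^tw(κ) − e_src(h)`.
[cite: KomaTasaki1994, §1] -/
theorem tendsto_sourcedHelicityChord_div_sq (t' U μ h : ℝ) (κ : Fin 2 → Circle)
    (Ls : ℕ → ℕ) [∀ j, NeZero (Ls j)] (hLs : Tendsto Ls atTop atTop) (n : ∀ j, Fin 2 → ZMod (Ls j))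
    (hn : ∀ j i, ZMod.toCircle (n j i) = κ i) :
    Tendsto (fun j => ((dWaveSourceTorusTT'Twist (Ls j) t' U μ h (n j)).groundEnergy -
        (dWaveSourceTorusTT' (Ls j) t' U μ h).groundEnergy) / ((Ls j : ℕ) : ℝ) ^ 2) atTop
      (𝓝 (dWaveSourceEnergyDensityTT'Twist t' U μ h κ - dWaveSourceEnergyDensityTT' t' U μ h)) := by
  refine ((tendsto_groundEnergy_dWaveSourceTorusTT'Twist_div_sq t' U μ h κ Ls hLs n hn).sub
    (tendsto_groundEnergy_dWaveSourceTorusTT'_div_sq_comp hLs t' U μ h)).congr fun j => ?_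
  rw [sub_div]

/-- **TL CEILING ON THE HELICITY CHORD DENSITY, limit form**: for every `κ ∈ U(1)²` realised on some
trivial-holonomy sequence — in particular every `χ_b(p)` —
`e_src^tw(t',U,μ,h;κ) − e_src(t',U,μ,h) ≤ e_src(t',U,μ,0) − e_src(t',U,μ,h)` (the finite-torus «chord ≤ gain»,
`sourcedHelicityChord_le_sourcedGain`, in the limit). [cite: KomaTasaki1994, §1] -/
theorem helicityChordDensity_le_sourcedGainDensity (t' U μ h : ℝ) (κ : Fin 2 → Circle)
    (Ls : ℕ → ℕ) [∀ j, NeZero (Ls j)] (hLs : Tendsto Ls atTop atTop) (n : ∀ j, Fin 2 → ZMod (Ls j))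
    (hn : ∀ j i, ZMod.toCircle (n j i) = κ i) :
    dWaveSourceEnergyDensityTT'Twist t' U μ h κ - dWaveSourceEnergyDensityTT' t' U μ h ≤
      dWaveSourceEnergyDensityTT' t' U μ 0 - dWaveSourceEnergyDensityTT' t' U μ h := by
  have hgain : Tendsto (fun j => ((dWaveSourceTorusTT' (Ls j) t' U μ 0).groundEnergy -
      (dWaveSourceTorusTT' (Ls j) t' U μ h).groundEnergy) / ((Ls j : ℕ) : ℝ) ^ 2) atTop
      (𝓝 (dWaveSourceEnergyDensityTT' t' U μ 0 - dWaveSourceEnergyDensityTT' t' U μ h)) := by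
    refine ((tendsto_groundEnergy_dWaveSourceTorusTT'_div_sq_comp hLs t' U μ 0).sub
      (tendsto_groundEnergy_dWaveSourceTorusTT'_div_sq_comp hLs t' U μ h)).congr fun j => ?_
    rw [sub_div]
  refine le_of_tendsto_of_tendsto (tendsto_sourcedHelicityChord_div_sq t' U μ h κ Ls hLs n hn) hgain ?_
  filter_upwards [hLs.eventually_ge_atTop 3] with j hj
  exact div_le_div_of_nonneg_right (sourcedHelicityChord_le_sourcedGain (Ls j) hj t' U μ h (n j)) (sq_nonneg _)

/-- The chord density is eventually below the gain density plus any `ε > 0` along every trivial-holonomy sequence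
(the `∀ᶠ` reading of the ceiling for finite-`L` consumers). [cite: KomaTasaki1994, §1] -/
theorem eventually_sourcedHelicityChord_div_sq_le_of_seq (t' U μ h : ℝ) (Ls : ℕ → ℕ) [∀ j, NeZero (Ls j)]
    (hLs : Tendsto Ls atTop atTop) (n : ∀ j, Fin 2 → ZMod (Ls j)) {ε : ℝ} (hε : 0 < ε) :
    ∀ᶠ j in atTop, ((dWaveSourceTorusTT'Twist (Ls j) t' U μ h (n j)).groundEnergy -
        (dWaveSourceTorusTT' (Ls j) t' U μ h).groundEnergy) / ((Ls j : ℕ) : ℝ) ^ 2 ≤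
      dWaveSourceEnergyDensityTT' t' U μ 0 - dWaveSourceEnergyDensityTT' t' U μ h + ε := by
  have hgain : Tendsto (fun j => ((dWaveSourceTorusTT' (Ls j) t' U μ 0).groundEnergy -
      (dWaveSourceTorusTT' (Ls j) t' U μ h).groundEnergy) / ((Ls j : ℕ) : ℝ) ^ 2) atTop
      (𝓝 (dWaveSourceEnergyDensityTT' t' U μ 0 - dWaveSourceEnergyDensityTT' t' U μ h)) := by
    refine ((tendsto_groundEnergy_dWaveSourceTorusTT'_div_sq_comp hLs t' U μ 0).sub
      (tendsto_groundEnergy_dWaveSourceTorusTT'_div_sq_comp hLs t' U μ h)).congr fun j => ?_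
    rw [sub_div]
  have hlim := hgain.eventually (Iic_mem_nhds (lt_add_of_pos_right
    (dWaveSourceEnergyDensityTT' t' U μ 0 - dWaveSourceEnergyDensityTT' t' U μ h) hε))
  filter_upwards [hlim, hLs.eventually_ge_atTop 3] with j hj hj3
  exact le_trans (div_le_div_of_nonneg_right (sourcedHelicityChord_le_sourcedGain (Ls j) hj3 t' U μ h (n j))
    (sq_nonneg _)) hj

/-- The ladder form of the ceiling: `e_src^tw(χ_b(p)) − e_src(h) ≤ e_src(0) − e_src(h)` for every `b ≥ 1`, `p ∈ ℕ²`.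
[cite: KomaTasaki1994, §1] -/
theorem helicityChordDensity_ladder_le_sourcedGainDensity (t' U μ h : ℝ) (b : ℕ) [NeZero b] (p : Fin 2 → ℕ) :
    dWaveSourceEnergyDensityTT'Twist t' U μ h (fun i => ZMod.toCircle ((p i : ℕ) : ZMod b)) -
        dWaveSourceEnergyDensityTT' t' U μ h ≤
      dWaveSourceEnergyDensityTT' t' U μ 0 - dWaveSourceEnergyDensityTT' t' U μ h :=
  helicityChordDensity_le_sourcedGainDensity t' U μ h _ (fun m => b * (m + 1))
    ((tendsto_add_atTop_nat 1).const_mul_atTop' (Nat.pos_of_ne_zero (NeZero.ne b)))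
    (fun m i => ((p i * (m + 1) : ℕ) : ZMod (b * (m + 1)))) (fun m i => toCircle_mul_eq b (m + 1) (p i))

/-- **For `h ≥ 0` the twisted energy density lies in the sourced window**:
`e_src(t',U,μ,h) + (e_src^tw(κ) − e_src(h)) ≤ e_src(t',U,μ,0)`, i.e. `e_src^tw(t',U,μ,h;κ) ≤ e_src(t',U,μ,0)` for
every `κ` realised on a trivial-holonomy sequence (the twisted sourced torus is below the sourceless one, whose
energy does not see a pure-gauge twist). [cite: KomaTasaki1994, §1] -/
theorem dWaveSourceEnergyDensityTT'Twist_le_zero_source (t' U μ h : ℝ) (κ : Fin 2 → Circle)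
    (Ls : ℕ → ℕ) [∀ j, NeZero (Ls j)] (hLs : Tendsto Ls atTop atTop) (n : ∀ j, Fin 2 → ZMod (Ls j))
    (hn : ∀ j i, ZMod.toCircle (n j i) = κ i) :
    dWaveSourceEnergyDensityTT'Twist t' U μ h κ ≤ dWaveSourceEnergyDensityTT' t' U μ 0 := by
  have h := helicityChordDensity_le_sourcedGainDensity t' U μ h κ Ls hLs n hn
  linarith

end Ladder

end Literature.MathematicalPhysics.QuantumLattice

end
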